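import Summits.ValiantsHypothesis.ValiantsHypothesis.Theorems.NewtonUnitEquationsTwoProductsRankOneThreeGenLawSlice
import HarnessLib

/-!
# Route NewtonUnitEquations — crux `TwoProducts` (stmt-ValiantsHypothesis-5906), line `relation_ladder`, rung R7b (rank one on THREE
# letters, ALL coefficient patterns `p•α = q•β + r•γ`) + rung R7c (TWO letters with torsion): the DILATED FREE LIFT — part 3/7 — exceptional exponents, the support criterion, `xOf` (T4 end)

(T4, end) `exc_apply`, `multinomial_exc`, `Fsl_exc`, `coeff_free_logTrunc_exc`, `mem_support_free_logTrunc_iff`, shape lemma, `Fsl_zero_zero`, `xOf`.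

val-idea-8 g3 (ideator; lens decomp), 2026-08-28.  THE GENERAL THREE-LETTER RANK-ONE LAW `p•α = q•β + r•γ` (all `p, q ≥ 1`, `r ≥ 0`):
lift `α ↦ Y_b^q Y_c^r, β ↦ Y_b^p, γ ↦ Y_c^p` over the `p`-DILATED plane (`enumP : b ↦ β, c ↦ γ, i ↦ p•enum i`), fibres `k` with divisibility
guards `p ∣ x_b − qk`, `p ∣ x_c − rk`, letter count `B_k = k + (x_b−qk)/p + (x_c−rk)/p`, DOUBLE SLICING `(b₁, b₂) = (x_b, x_c)`, the coefficient
theorem with `Pfac · C(R + B_k − 1, B_k) · κ_k`, finite SHIFT RANK and val-lit-p3's `ShiftRank.pencilCount` BY NAME; large or absent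
coefficients/letters are permutation type (R3♯).  Instances: R6b (1;1,1), R6c (2;1,1), R7a (p = 1, `visible_bound_free`), R6d = val-lit-p3's
homogeneous shape (p = q + r, `visible_bound_hom`), and rung R7c = rank one on TWO letters with torsion `p•α = q•β` (`r = 0`, idle third letter).

PORT NOTE (val-lit-p3 g15, prover seat, helper mode `--supports stmt-ValiantsHypothesis-5906 --as helper`, no stub credit claimed; the author's
request val-width INBOX 12:15Z/12:19Z + desk RULING #279 (c)): part 3/7 of a VERBATIM Theorems-side port of val-idea-8 g3's sorry-free module
`Cruxes/TwoProducts/Lines/relation_ladder_R7b.lean` REV 2 (tree sha256 f9e10d1fedcbd387…; 1 890 lines; `lean check` rc 0, 0 sorries,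
0 warnings, axioms standard).  ALL mathematics and ALL proofs are val-idea-8 g3's.  Port changes only: (i) file split + import chain;
(ii) declarations re-declared verbatim from LANDED ports are referenced BY NAME instead — `R6b.sum_sgn`, `R6b.HSD` (+ six closure
lemmas), `R6b.hsd_binChar` (R6b port); `tab`, `sgn`, `toolBound_mono` (R6 port, parent namespace); `R7a.SIdx`, `R7a.card_SIdx`,
`R7a.msetT_apply_le`, `R7a.permType_of_rankOne_largeCoeff`, `R7a.permType_of_rankOne_absent` (R7a port); `rankOne_symm` =
`R6c.rankOneCoincidences_symm` (R6c); `wt_nsmul'` = `FormalLogLinearisation.wt_nsmul`; (iii) section variables α-renamed `I ↦ Ig`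
(QIdx datum), `D ↦ Dg` (RelData datum) — forced by the gate's textual statement index (`dedup.landed`), since the R6b / R7a ports own
same-text lemmas over `ThreeIdx` / `QIdx`; (iv) docstrings on API lemmas; (v) in part 7/7 the parameter-free `def RankOneThreeGenLaw : Prop`
and `def RankOneTwoLaw : Prop` are NOT declared (relocation rule) — the laws are stated by their LITERAL bodies as `rankOneThreeGenLaw_proof`
and `rankOneTwoLaw_proof`; `visible_bound_free` / `visible_bound_hom` keep their names and texts.  Namespace = the author's
(`…PermutationType.R7b`).  Nothing here closes the line's residual, the crux `TwoProducts` (5906) or `VP ≠ VNP`; no summit statement is proved.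

Honest scope (the author's): rank one on FOUR letters with general coefficients, relations on ≥ 5 letters, one-sided `p•α = Σ qᵢ βᵢ` (R8, memo
only) and coincidence rank ≥ 2 are NOT covered here.  Nothing here moves VP ≠ VNP; `TwoProducts` (5906) stays OPEN. [folklore]
-/

noncomputable section

-- Sub = Summit single-conjunct layout: the duplicated namespace component is mandated by the tree.
set_option linter.dupNamespace false
set_option linter.unusedSimpArgs false
set_option linter.deprecated false
set_option linter.unusedSectionVars false
set_option linter.unusedVariables false
set_option linter.unnecessarySeqFocus false

namespace Summit.ValiantsHypothesis.ValiantsHypothesis.Theorems.NewtonUnitEquations.TwoProducts.PermutationType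
namespace R7b
open scoped BigOperators
open MvPolynomial

variable {σ : Type*} [Fintype σ] [DecidableEq σ]

variable (Ig : QIdx σ)

section Slice
variable {m : ℕ}

/-- `exc_apply` — technical lemma of the R7b dilated free-lift toolkit (val-idea-8 g3). [folklore] -/
theorem exc_apply (x : σ →₀ ℕ) (hx : x Ig.a = 0) (h0 : deg (xhat Ig x) = 0) (j : σ) (hjb : j ≠ Ig.b) (hjc : j ≠ Ig.c) :
    x j = 0 := by
  have hz : xhat Ig x = 0 := (deg_eq_zero_iff _).mp h0
  by_cases hja : j = Ig.a
  · rw [hja, hx]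
  · have := DFunLike.congr_fun hz j
    rwa [xhat_other Ig x j hja hjb hjc] at this

/-- `xhat_exc_apply` — technical lemma of the R7b dilated free-lift toolkit (val-idea-8 g3). [folklore] -/
theorem xhat_exc_apply (x : σ →₀ ℕ) (h0 : deg (xhat Ig x) = 0) (j : σ) : xhat Ig x j = 0 := by
  rw [(deg_eq_zero_iff _).mp h0]; rfl

/-- `restProd_exc` — technical lemma of the R7b dilated free-lift toolkit (val-idea-8 g3). [folklore] -/
theorem restProd_exc (t : σ → ℂ) (x : σ →₀ ℕ) (h0 : deg (xhat Ig x) = 0) : restProd Ig t ⇑(xhat Ig x) = 1 := by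
  unfold restProd
  exact Finset.prod_eq_one fun j _ => by rw [xhat_exc_apply Ig x h0 j, pow_zero]

/-- `multinomial_exc` — technical lemma of the R7b dilated free-lift toolkit (val-idea-8 g3). [folklore] -/
theorem multinomial_exc (x : σ →₀ ℕ) (hx : x Ig.a = 0) (h0 : deg (xhat Ig x) = 0) (k : ℕ) (hk : k ∈ KR Ig x) :
    ((Lof Ig x k).multinomial : ℂ) = kap Ig (x Ig.b) (x Ig.c) k := by
  have hdeg := deg_Lof_eq Ig x k hk
  rw [h0, zero_add] at hdeg
  have s := Nat.multinomial_spec (Finset.univ : Finset σ) (Lof Ig x k)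
  rw [← multinomial_univ, ← deg_eq_sum, prod_three_split Ig, Lof_a, Lof_b, Lof_c, hdeg] at s
  have hr : ∏ j ∈ rest Ig, ((Lof Ig x k) j).factorial = 1 := by
    refine Finset.prod_eq_one fun j hj => ?_
    rw [mem_rest] at hj
    rw [Lof_other Ig x k j hj.1 hj.2.1 hj.2.2, exc_apply Ig x hx h0 j hj.2.1 hj.2.2, Nat.factorial_zero]
  rw [hr, one_mul] at s
  have hKd : (((k.factorial * ((x Ig.b - Ig.q * k) / Ig.p).factorial * ((x Ig.c - Ig.r * k) / Ig.p).factorial : ℕ)) : ℂ) ≠ 0 :=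
    Nat.cast_ne_zero.mpr (Nat.mul_ne_zero (Nat.mul_ne_zero (Nat.factorial_ne_zero _) (Nat.factorial_ne_zero _))
      (Nat.factorial_ne_zero _))
  unfold kap
  rw [eq_div_iff hKd]
  have e : (((k.factorial * (((x Ig.b - Ig.q * k) / Ig.p).factorial * ((x Ig.c - Ig.r * k) / Ig.p).factorial) *
      (Lof Ig x k).multinomial : ℕ)) : ℂ) = (((Bk Ig (x Ig.b) (x Ig.c) k).factorial : ℕ) : ℂ) := by exact_mod_cast s
  push_cast at e ⊢
  linear_combination e

/-- The signed atom sum of the constants of an admissible `k`. [folklore] -/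
theorem sum_mainConst (c d : Fin m → σ → ℂ) (b₁ b₂ k : ℕ) (hk : Adm Ig b₁ b₂ k) :
    ∑ j, mainConst Ig c d b₁ b₂ j k = (-1 : ℂ) ^ (b₁ + b₂ + Bk Ig b₁ b₂ k) * kap Ig b₁ b₂ k *
      (∑ j : Fin m, c j Ig.a ^ k * c j Ig.b ^ ((b₁ - Ig.q * k) / Ig.p) * c j Ig.c ^ ((b₂ - Ig.r * k) / Ig.p) -
        ∑ j : Fin m, d j Ig.a ^ k * d j Ig.b ^ ((b₁ - Ig.q * k) / Ig.p) * d j Ig.c ^ ((b₂ - Ig.r * k) / Ig.p)) := by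
  rw [Fintype.sum_sum_type]
  simp only [mainConst, gd_pos Ig hk, tab, sgn, Sum.elim_inl, Sum.elim_inr]
  rw [mul_sub, Finset.mul_sum, Finset.mul_sum, sub_eq_add_neg, ← Finset.sum_neg_distrib]
  congr 1
  · exact Finset.sum_congr rfl fun j _ => by ring
  · exact Finset.sum_congr rfl fun j _ => by ring

/-- The slice function at the exceptional point: only the correction survives. [folklore] -/
theorem Fsl_exc (c d : Fin m → σ → ℂ) (b₁ b₂ : ℕ) (hb : 1 ≤ b₁ + b₂) (ν : σ → ℕ) (hν : ∀ j, ν j = 0) :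
    R7b.Fsl Ig c d b₁ b₂ ν = ∑ j : Fin m ⊕ Fin m, ∑ k : Fin (b₁ + b₂ + 1), R7b.mainConst Ig c d b₁ b₂ j k / ((R7b.Bk Ig b₁ b₂ k : ℕ) : ℂ) := by
  have hmain : ∑ j : Fin m ⊕ Fin m, ∑ k : Fin (b₁ + b₂ + 1), mainTerm Ig c d b₁ b₂ j k ν = 0 := by
    refine Finset.sum_eq_zero fun j _ => Finset.sum_eq_zero fun k _ => ?_
    unfold mainTerm
    by_cases hk : Adm Ig b₁ b₂ k
    · have hlam : lam Ig ν = 0 := by unfold lam; simp [hν]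
      have hB := Bk_pos Ig hk hb
      rw [hlam, Nat.choose_eq_zero_of_lt (by omega)]
      simp
    · rw [mainConst_eq_zero Ig c d hk j, zero_mul]
  unfold Fsl
  rw [hmain, mul_zero, zero_add]
  unfold corr
  rw [if_pos hν]

/-- **THE COEFFICIENT THEOREM at the exceptional exponent** `x = b₁ e_β + b₂ e_γ ≠ 0`. [folklore] -/
theorem coeff_free_logTrunc_exc (c d : Fin m → σ → ℂ) (R : ℕ) (x : σ →₀ ℕ) (hx : x Ig.a = 0)
    (h0 : deg (xhat Ig x) = 0) (hbc : 1 ≤ x Ig.b + x Ig.c) (hR : deg x ≤ R) :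
    coeff x (phiT (frM Ig) (logTrunc c d R)) =
      (-1 : ℂ) ^ (x Ig.b + x Ig.c + 1) * Fsl Ig c d (x Ig.b) (x Ig.c) ⇑(xhat Ig x) := by
  classical
  rw [coeff_phiT_frM Ig _ x hx]
  have hdx : deg x = x Ig.b + x Ig.c := by rw [deg_eq_deg_xhat_add Ig x, hx, h0, zero_add, zero_add]
  have hz : ∀ j, (xhat Ig x) j = 0 := xhat_exc_apply Ig x h0
  rw [Fsl_exc Ig c d (x Ig.b) (x Ig.c) hbc _ hz, Finset.sum_comm, Finset.mul_sum]
  rw [Fin.sum_univ_eq_sum_range (fun k => (-1 : ℂ) ^ (x Ig.b + x Ig.c + 1) *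
    ∑ j : Fin m ⊕ Fin m, mainConst Ig c d (x Ig.b) (x Ig.c) j k / ((Bk Ig (x Ig.b) (x Ig.c) k : ℕ) : ℂ)) (x Ig.b + x Ig.c + 1)]
  unfold KR
  rw [Finset.sum_filter]
  refine Finset.sum_congr rfl fun k _ => ?_
  by_cases hk : Adm Ig (x Ig.b) (x Ig.c) k
  · rw [if_pos hk]
    have hkm : k ∈ KR Ig x := (mem_KR Ig x k).2 hk
    have hdeg := deg_Lof_eq Ig x k hkm
    rw [h0, zero_add] at hdeg
    have hB1 := Bk_pos Ig hk hbc
    have hBle := Bk_le Ig hk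
    have hdeg1 : 1 ≤ deg (Lof Ig x k) := by omega
    have hdegR : deg (Lof Ig x k) ≤ R := by omega
    rw [coeff_logTrunc c d R _ hdeg1 hdegR, multinomial_exc Ig x hx h0 k hkm, hdeg]
    have hsign : (-1 : ℂ) ^ (Bk Ig (x Ig.b) (x Ig.c) k + 1) =
        (-1) ^ (x Ig.b + x Ig.c + 1) * (-1) ^ (x Ig.b + x Ig.c + Bk Ig (x Ig.b) (x Ig.c) k) := by
      have e : x Ig.b + x Ig.c + 1 + (x Ig.b + x Ig.c + Bk Ig (x Ig.b) (x Ig.c) k) =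
          (Bk Ig (x Ig.b) (x Ig.c) k + 1) + 2 * (x Ig.b + x Ig.c) := by omega
      rw [← pow_add, e, pow_add (-1 : ℂ) (Bk Ig (x Ig.b) (x Ig.c) k + 1), pow_mul]
      norm_num
    rw [hsign, ← Finset.sum_div, sum_mainConst Ig c d _ _ k hk]
    simp only [mom_Lof Ig _ x k, restProd_exc Ig _ x h0, mul_one]
    ring
  · rw [if_neg hk]
    rw [Finset.sum_eq_zero (fun j _ => by rw [mainConst_eq_zero Ig c d hk j, zero_div]), mul_zero]

/-- **The support criterion**: `x ≠ 0` with `x_a = 0` and `deg x ≤ R` lies in the support of the free lift of `Λ_R` iff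
`F_{x_b, x_c}(x̂) ≠ 0`. [folklore] -/
theorem mem_support_free_logTrunc_iff (c d : Fin m → σ → ℂ) (R : ℕ) (x : σ →₀ ℕ) (hx : x Ig.a = 0) (hne : x ≠ 0)
    (hR : deg x ≤ R) :
    x ∈ (phiT (frM Ig) (logTrunc c d R)).support ↔ Fsl Ig c d (x Ig.b) (x Ig.c) ⇑(xhat Ig x) ≠ 0 := by
  rw [mem_support_iff]
  by_cases h1 : 1 ≤ deg (xhat Ig x)
  · rw [coeff_free_logTrunc Ig c d R x hx h1 hR]
    have hc : (-1 : ℂ) ^ (deg x + 1) * Pfac Ig x ≠ 0 :=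
      mul_ne_zero (pow_ne_zero _ (neg_ne_zero.mpr one_ne_zero)) (Pfac_ne_zero Ig x)
    constructor
    · intro h hF; exact h (by rw [hF, mul_zero])
    · intro h; exact mul_ne_zero hc h
  · have h0 : deg (xhat Ig x) = 0 := by omega
    have hbc : 1 ≤ x Ig.b + x Ig.c := by
      by_contra h
      apply hne
      ext j
      by_cases hjb : j = Ig.b
      · subst hjb; simp; omega
      by_cases hjc : j = Ig.c
      · subst hjc; simp; omega
      rw [exc_apply Ig x hx h0 j hjb hjc]; rfl
    rw [coeff_free_logTrunc_exc Ig c d R x hx h0 hbc hR]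
    have hc : (-1 : ℂ) ^ (x Ig.b + x Ig.c + 1) ≠ 0 := pow_ne_zero _ (neg_ne_zero.mpr one_ne_zero)
    constructor
    · intro h hF; exact h (by rw [hF, mul_zero])
    · intro h; exact mul_ne_zero hc h

/-- Non-vanishing of a slice function forces `ν_a = ν_b = ν_c = 0`. [folklore] -/
theorem shape_of_Fsl_ne_zero (c d : Fin m → σ → ℂ) (b₁ b₂ : ℕ) (ν : σ → ℕ) (h : Fsl Ig c d b₁ b₂ ν ≠ 0) :
    ν Ig.a = 0 ∧ ν Ig.b = 0 ∧ ν Ig.c = 0 := by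
  by_contra hcon
  apply h
  unfold Fsl ind corr
  rw [if_neg hcon, zero_mul, zero_add, if_neg]
  intro hall
  exact hcon ⟨hall Ig.a, hall Ig.b, hall Ig.c⟩

/-- The slice function of the slice `(0, 0)` vanishes at the origin (equal numbers of `±` atoms). [folklore] -/
theorem Fsl_zero_zero (c d : Fin m → σ → ℂ) (ν : σ → ℕ) (hν : ∀ j, ν j = 0) : Fsl Ig c d 0 0 ν = 0 := by
  have hB : Bk Ig 0 0 0 = 0 := by unfold Bk; simp
  have hkap : kap Ig 0 0 0 = 1 := by unfold kap; rw [hB]; simp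
  have hgd : gd Ig 0 0 0 = 1 := by
    unfold gd; rw [if_pos ⟨by simp, by simp, by simp, by simp⟩]
  have hmain : ∀ j : Fin m ⊕ Fin m, ∑ k : Fin (0 + 0 + 1), mainTerm Ig c d 0 0 j k ν = sgn m j := by
    intro j
    rw [Fin.sum_univ_one]
    show mainTerm Ig c d 0 0 j 0 ν = sgn m j
    unfold mainTerm mainConst restProd
    rw [hgd, hkap, hB]
    simp [hν]
  have hcorr : corr Ig c d 0 0 ν = 0 := by
    unfold corr
    rw [if_pos hν]
    have : ∀ j : Fin m ⊕ Fin m, ∑ k : Fin (0 + 0 + 1), mainConst Ig c d 0 0 j k / ((Bk Ig 0 0 k : ℕ) : ℂ) = 0 := by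
      intro j
      rw [Fin.sum_univ_one]
      show mainConst Ig c d 0 0 j 0 / ((Bk Ig 0 0 0 : ℕ) : ℂ) = 0
      rw [hB]; simp
    simp only [this, Finset.sum_const_zero]
  unfold Fsl
  rw [hcorr, add_zero]
  simp only [hmain, R6b.sum_sgn, mul_zero]

/-- The exponent with prescribed slices `(b₁, b₂)` and reduced part `ν` (`ν_a = ν_b = ν_c = 0`). [folklore] -/
def xOf (b₁ b₂ : ℕ) (ν : σ → ℕ) : σ →₀ ℕ :=
  ofFun fun j => if j = Ig.b then b₁ else if j = Ig.c then b₂ else if j = Ig.a then 0 else ν j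

/-- `xOf_b` — technical lemma of the R7b dilated free-lift toolkit (val-idea-8 g3). [folklore] -/
theorem xOf_b (b₁ b₂ : ℕ) (ν : σ → ℕ) : xOf Ig b₁ b₂ ν Ig.b = b₁ := by
  simp [xOf]

/-- `xOf_c` — technical lemma of the R7b dilated free-lift toolkit (val-idea-8 g3). [folklore] -/
theorem xOf_c (b₁ b₂ : ℕ) (ν : σ → ℕ) : xOf Ig b₁ b₂ ν Ig.c = b₂ := by
  simp [xOf, Ig.hbc.symm]

/-- `xOf_a` — technical lemma of the R7b dilated free-lift toolkit (val-idea-8 g3). [folklore] -/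
theorem xOf_a (b₁ b₂ : ℕ) (ν : σ → ℕ) : xOf Ig b₁ b₂ ν Ig.a = 0 := by
  simp [xOf, Ig.hab, Ig.hac]

/-- `xhat_xOf` — technical lemma of the R7b dilated free-lift toolkit (val-idea-8 g3). [folklore] -/
theorem xhat_xOf (b₁ b₂ : ℕ) (ν : σ → ℕ) (ha : ν Ig.a = 0) (hb : ν Ig.b = 0) (hc : ν Ig.c = 0) :
    ⇑(xhat Ig (xOf Ig b₁ b₂ ν)) = ν := by
  funext j
  by_cases hja : j = Ig.a
  · subst hja; rw [xhat_a, ha]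
  by_cases hjb : j = Ig.b
  · subst hjb; rw [xhat_b, hb]
  by_cases hjc : j = Ig.c
  · subst hjc; rw [xhat_c, hc]
  rw [xhat_other Ig _ j hja hjb hjc]
  simp [xOf, hja, hjb, hjc]

/-- `xOf_xhat` — technical lemma of the R7b dilated free-lift toolkit (val-idea-8 g3). [folklore] -/
theorem xOf_xhat (x : σ →₀ ℕ) (hx : x Ig.a = 0) : xOf Ig (x Ig.b) (x Ig.c) ⇑(xhat Ig x) = x := by
  ext j
  by_cases hjb : j = Ig.b
  · subst hjb; rw [xOf_b]
  by_cases hjc : j = Ig.c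
  · subst hjc; rw [xOf_c]
  by_cases hja : j = Ig.a
  · subst hja; rw [xOf_a, hx]
  simp [xOf, hjb, hjc, hja, xhat_other Ig x j hja hjb hjc]

end Slice

end R7b
end Summit.ValiantsHypothesis.ValiantsHypothesis.Theorems.NewtonUnitEquations.TwoProducts.PermutationType

end
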